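import Mathlib
import Summits.ValiantsHypothesis.ValiantsHypothesis.Theorems.KPlusLogSqLawWeakLiftingTowerGraftClusterDiscs

/-!
# Tower graft line — ISOLATED NEAR-AXIS EVENTS COST TWO CROSSINGS EACH (an instance of the T1 statement of record)

Mechanism file for the line `Cruxes/WeakLifting/Lines/tower_graft.lean` (crux `WeakLifting` = stmt-ValiantsHypothesis-19561, T1 «log-slope
localisation»); a disc-free COROLLARY of the statement of record `card_posRoots_add_X_pow_mul_le_of_discs` (`…TowerGraftClusterDiscs.lean`):
the disc system is supplied here — one disc of radius `(9/2)ρ‖z‖` (`ρ = (deg A + deg E)/D`) around each IN-SECTOR root `z` of `A·E` —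
under the hypothesis that in-sector roots are ISOLATED at that scale (`‖z − z′‖ ≥ (9/2)ρ‖z‖ + 4ρ‖z′‖` for every other root `z′`).
NO stub is claimed.

THE COROLLARY (`card_posRoots_add_X_pow_mul_le_of_isolated`).  `A, E ∈ ℝ[X]` non-zero, `0 < s ≤ 1`, `0 < D`, `5(deg A + deg E) ≤ s·D`,
isolation as above.  Then
`Z₊(A + X^D·E) ≤ 2·#{distinct in-sector roots of A·E} + 2·Z₊(E) + 1`
— real AND non-real near-axis events cost two crossings each when isolated; the one-sided real theorem `…RealEvents` (no isolation needed
there, by monotonicity) and the sector-free `…SectorFreeGraft` (no events: ≤ 1) are the neighbouring instances.  Clusters of events are the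
business of the general disc interface (`…_of_discs` / `…_of_rouche_discs`).
HONEST FRAMING: elementary packaging; nothing on S4/S4b/S5, TowerB, `WeakLifting`, B, 18050 or `VP ≠ VNP`.  Def-free.
Seat: prover val-sym-lift-p1 g20, `--supports stmt-ValiantsHypothesis-19561`.
-/

-- `Summit.ValiantsHypothesis.ValiantsHypothesis.…` repeats a component by the D-0017 layout
-- (single-conjunct summit), which the `dupNamespace` linter flags; the name is mandated.
set_option linter.dupNamespace false

namespace Summit.ValiantsHypothesis.ValiantsHypothesis.Theorems.KPlusLogSqLaw.TowerGraft

open Polynomial Complex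
open scoped BigOperators Polynomial Real

section Isolated

/-- **ISOLATED NEAR-AXIS EVENTS COST TWO EACH.**  See the module docstring. [this work] -/
theorem card_posRoots_add_X_pow_mul_le_of_isolated {s : ℝ} (hs : 0 < s) (hs1 : s ≤ 1) (A E : ℝ[X]) {D : ℕ} (hD : 0 < D)
    (hA : A ≠ 0) (hE : E ≠ 0) (hdeg : 5 * ((A.natDegree : ℝ) + E.natDegree) ≤ s * D)
    (hiso : ∀ z ∈ (A.map Complex.ofRealHom).roots + (E.map Complex.ofRealHom).roots,
      ¬ (s * ‖z‖ ≤ |z.im| ∨ z.re ≤ 0) →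
      ∀ z' ∈ (A.map Complex.ofRealHom).roots + (E.map Complex.ofRealHom).roots, z' ≠ z →
        (9 / 2) * (((A.natDegree : ℝ) + E.natDegree) / D) * ‖z‖ +
          4 * (((A.natDegree : ℝ) + E.natDegree) / D) * ‖z'‖ ≤ ‖z - z'‖) :
    ((A + X ^ D * E).roots.toFinset.filter (fun t => 0 < t)).card ≤
      2 * (((A.map Complex.ofRealHom).roots + (E.map Complex.ofRealHom).roots).filter
          fun z => ¬ (s * ‖z‖ ≤ |z.im| ∨ z.re ≤ 0)).toFinset.card +
        2 * (E.roots.toFinset.filter (fun t => 0 < t)).card + 1 := by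
  classical
  set n : ℝ := (A.natDegree : ℝ) + E.natDegree with hn
  set ρ : ℝ := n / D with hρ
  set Z := (A.map Complex.ofRealHom).roots + (E.map Complex.ofRealHom).roots with hZ
  set I : Finset ℂ := (Z.filter fun z => ¬ (s * ‖z‖ ≤ |z.im| ∨ z.re ≤ 0)).toFinset with hI
  have hD0 : (0 : ℝ) < D := by exact_mod_cast hD
  have hρ0 : 0 ≤ ρ := by positivity
  have hρ5 : ρ ≤ 1 / 5 := by
    rw [hρ, div_le_iff₀ hD0]; nlinarith
  have hdeg4 : 4 * ((A.natDegree : ℝ) + E.natDegree) ≤ s * D := by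
    have : 0 ≤ (A.natDegree : ℝ) + E.natDegree := by positivity
    linarith
  have hAc0 : A.map Complex.ofRealHom ≠ 0 := (Polynomial.map_ne_zero_iff Complex.ofRealHom.injective).mpr hA
  have hEc0 : E.map Complex.ofRealHom ≠ 0 := (Polynomial.map_ne_zero_iff Complex.ofRealHom.injective).mpr hE
  have hZF : ((A * E).map Complex.ofRealHom).roots = Z := by
    rw [Polynomial.map_mul, Polynomial.roots_mul (mul_ne_zero hAc0 hEc0), hZ]
  -- members of `I`
  have hImem : ∀ z ∈ I, z ∈ Z ∧ ¬ (s * ‖z‖ ≤ |z.im| ∨ z.re ≤ 0) := by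
    intro z hz
    rw [hI, Multiset.mem_toFinset, Multiset.mem_filter] at hz
    exact hz
  have hIne0 : ∀ z ∈ I, z ≠ 0 := by
    intro z hz h0
    have h := (hImem z hz).2
    rw [h0] at h
    exact h (Or.inr (by simp))
  -- `ρ > 0` as soon as a root exists
  have hcardZ : (Multiset.card Z : ℝ) = n := by
    rw [hZ, Multiset.card_add, Nat.cast_add,
      ← (IsAlgClosed.splits (A.map Complex.ofRealHom)).natDegree_eq_card_roots,
      ← (IsAlgClosed.splits (E.map Complex.ofRealHom)).natDegree_eq_card_roots,
      Polynomial.natDegree_map_eq_of_injective Complex.ofRealHom.injective,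
      Polynomial.natDegree_map_eq_of_injective Complex.ofRealHom.injective, hn]
  have hρpos : ∀ z ∈ Z, 0 < ρ := by
    intro z hz
    have hc : (0 : ℝ) < Multiset.card Z := by exact_mod_cast Multiset.card_pos_iff_exists_mem.mpr ⟨z, hz⟩
    rw [hcardZ] at hc
    exact div_pos hc hD0
  -- the disc system: one disc of radius `(9/2)ρ‖z‖` around each in-sector root
  have hmain := card_posRoots_add_X_pow_mul_le_of_discs hs hs1 A E hD hA hE hdeg4 I (fun z => z)
    (fun z => (9 / 2) * ρ * ‖z‖) ?hrad ?h0 ?hclear ?hcover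
  case hrad =>
    intro z hz
    exact mul_pos (mul_pos (by norm_num) (hρpos z (hImem z hz).1)) (norm_pos_iff.mpr (hIne0 z hz))
  case h0 =>
    intro z hz τ hτ hτ0
    rw [Metric.mem_sphere, dist_eq_norm, hτ0, zero_sub, norm_neg] at hτ
    have hzpos : 0 < ‖z‖ := norm_pos_iff.mpr (hIne0 z hz)
    nlinarith
  case hclear =>
    intro z hz τ hτ z' hz'
    rw [Metric.mem_sphere, dist_eq_norm] at hτ
    by_cases hzz : z' = z
    · subst hzz
      rw [hτ]
      nlinarith [norm_nonneg z', hρpos z' hz']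
    · have hsep := hiso z (hImem z hz).1 (hImem z hz).2 z' hz' hzz
      have htri : ‖z - z'‖ ≤ ‖τ - z‖ + ‖τ - z'‖ := by
        have := norm_sub_le_norm_sub_add_norm_sub z τ z'
        rwa [norm_sub_rev z τ] at this
      show 4 * ρ * ‖z'‖ ≤ ‖τ - z'‖
      linarith
  case hcover =>
    intro z hz hzin t ht hclose
    refine ⟨z, ?_, ?_⟩
    · rw [hI, Multiset.mem_toFinset, Multiset.mem_filter]; exact ⟨hz, hzin⟩
    · show dist (t : ℂ) z < (9 / 2) * ρ * ‖z‖
      rw [dist_eq_norm]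
      have hclose' : ‖(t : ℂ) - z‖ ≤ 4 * ρ * ‖z‖ := hclose
      have hzne : z ≠ 0 := fun h0 => hzin (Or.inr (by rw [h0]; simp))
      have : 0 < ρ * ‖z‖ := mul_pos (hρpos z hz) (norm_pos_iff.mpr hzne)
      linarith
  -- each disc contains exactly its own root among the roots of `A·E`
  have hdisc : ∀ z ∈ I, ((((A * E).map Complex.ofRealHom).roots.filter fun w => dist w z < (9 / 2) * ρ * ‖z‖).toFinset).card = 1 := by
    intro z hz
    rw [Finset.card_eq_one]
    refine ⟨z, Finset.eq_singleton_iff_unique_mem.mpr ⟨?_, ?_⟩⟩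
    · rw [Multiset.mem_toFinset, Multiset.mem_filter, hZF, dist_self]
      exact ⟨(hImem z hz).1, mul_pos (mul_pos (by norm_num) (hρpos z (hImem z hz).1)) (norm_pos_iff.mpr (hIne0 z hz))⟩
    · intro w hw
      rw [Multiset.mem_toFinset, Multiset.mem_filter, hZF, dist_eq_norm] at hw
      by_contra hwz
      have hsep := hiso z (hImem z hz).1 (hImem z hz).2 w hw.1 hwz
      rw [norm_sub_rev] at hsep
      have : 0 ≤ 4 * ρ * ‖w‖ := by positivity
      linarith [hw.2]
  have hsum : ∑ z ∈ I, ((((A * E).map Complex.ofRealHom).roots.filter fun w => dist w z < (9 / 2) * ρ * ‖z‖).toFinset).card = I.card := by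
    rw [Finset.card_eq_sum_ones]
    exact Finset.sum_congr rfl hdisc
  have hIeq : I.card = ((((A.map Complex.ofRealHom).roots + (E.map Complex.ofRealHom).roots).filter
      fun z => ¬ (s * ‖z‖ ≤ |z.im| ∨ z.re ≤ 0)).toFinset).card := by rw [hI, hZ]
  rw [hsum] at hmain
  rw [← hIeq]
  exact hmain

end Isolated

end Summit.ValiantsHypothesis.ValiantsHypothesis.Theorems.KPlusLogSqLaw.TowerGraft
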